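import Literature.MathematicalPhysics.QuantumFieldTheory.Balaban1983to89.B8Prop6CubeMemberEq137
import Literature.MathematicalPhysics.QuantumFieldTheory.Balaban1983to89.B8LeafModelZd3

/-!
# `Balaban1983to89.B8Prop6CubeMemberNorms` — [Balaban1985RegularSpaces] PROPOSITION 6 (p. 99), THE DERIVATIVE MEMBERS (1.136)₂–₄
# «(Lʲη)²|∇^ηA|, (Lʲη)³|∂^{η*}∂^ηA|, (Lʲη)³|Δ^ηA| < 7dL²B₁Mα₀ on □_j» AT THE CONCRETE CUBE MEMBER: Proposition 3 (p. 87) at the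
# background `1` on the cube family, fed by the all-levels (1.37) clause of the gauge-fixed field

statement-level skeleton of published theorems with citation tags; proofs where landed; nothing here is a claim about the
Yang–Mills mass gap

T. Bałaban, *Spaces of regular gauge field configurations on a lattice and gauge fixing conditions*, Commun. Math. Phys. **99**
(1985) 75–102 `[Balaban1985RegularSpaces]` ("B8"), Sect. F p. 99 (Proposition 6), Proposition 3 p. 87, (1.40)–(1.42) p. 83, (1.61) p. 86,
Theorem 4 p. 88 and the sentence after it («Proposition 3 implies that it is enough to prove (1.37), (1.38) and |A| < B′₁(α₀ + α₁)(Lʲη)⁻¹»).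

CITATION HEADER (lean-in-tree rule).  Cell `pub-ymgap` (YM Track A, HUMAN RULING D-0062), DAG node N05 = [B8], seat `pub-ymgap-dag-n05-e`
(R141 (C) fan-out; FAN-OUT v1.1 §N05 row s3b, module 3b-i of the n05-c ∕ n05-e division).  WHY: print obtains Proposition 6 by applying
THEOREM 2's conclusions (1.36)–(1.39) to the pair `(1, U₀″)` on the cube family («thus there exists a gauge transformation u such that
U₁ = U₀″^{u⁻¹} satisfies the conditions (1.36)–(1.39)», p. 99); Theorem 2 = Theorem 4 + Proposition 3 (p. 88).  The kernel half of row s3b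
(`B8Prop6CubeMemberFlat.prop6_asPrinted_cubeMember_at`, seat n05-c) lands Theorem 4's output at the member: `u` with (1.29), (1.38) of
record and the (1.62)-shape `|A| ≤ B′₁(α₀′ + α₁′)(Lʲη)⁻¹`, `(α₀′, α₁′) = (L³α₀, 6dL²Mα₀)`.  THIS MODULE supplies Proposition 3's two
remaining inputs at the member and applies it: (1.42)₂ «|Q_j(U₀, ηA)| < 2dLα₁» at all levels (`B8Eq142KLevelLocal.H42_of_inAx` at the
background `1`, from (1.132)–(1.133) of `U₀″`), and PROPOSITION 3 in the tree's printed form `B8.Prop3Printed` on the `ℤᵈ` family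
(`B8LeafModelZd3.prop3Printed_zd3`, modulo its [4]-Thm-3.3 socket `SockB9P3`) AT THE CUBE MEMBER of `B8CubeMemberZd` — giving (1.136)₂–₄
and the Hölder member of (1.36) in the lineage's k-level norm currency with Proposition 3's constant `5dLB₀·(L³α₀ + 6dL²Mα₀)`
(`≤ 7dL²B₁Mα₀`, `B₁ = 5dLB₀`, when `L ≤ dM`: `B8Prop6OfThm4.const_136`).  Kind «kernel-checked proof», theorems only, no `def`.

DICTIONARY (nothing new).  `A := B8LeafModelZd3.mlogCfg k η {□_j} U₁` (`(1∕iη) log U₁` on the bonds of the plaquettes touching some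
`□_j`, `0` elsewhere — the exponent field of every (1.36)∕(1.37)∕(1.39) member of `B8LeafModelZd3.zdGF3`), `U₁ = U₀″^{u⁻¹} =
gaugeAct u⁻¹ (cutFixed …)`; `|∇^ηA|₍₋₂₎ = msup (−2)` of the forward covariant differences at background `1` over the sides of the plaquettes
touching `□_j`; `|∂^{η*}∂^ηA|₍₋₃₎ ∕ |Δ^ηA|₍₋₃₎ = bondNorm (−3)` of `pdiv ∘ plaqCovDeriv` ∕ `covLap`; Hölder member = `msup (−(2+β))` of [4]
(3.40)'s quotients (`B9Eq340HolderZd.hquot`); all-levels (1.37) = `‖Q_j(1, iηA)(c)‖ < 2dLα₁′` on `B8CubeMemberZd.cubeLamB … k j`.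

WHAT THIS MODULE PROVES (kernel, 0 sorry).  §1 **`c137_cubeMember`** — (1.42)₂ ∕ (1.37) at all levels at the member for ANY unitary
`u` with (1.29) at level `k` and the (1.62)-shape `≤ α₂(Lʲη)⁻¹` (`j ≤ k`): `H42_of_inAx` BY NAME at `(U₀, U′) := (1, U₀″)`, `(α₀, α₁, α₂)
:= (L³α₀, 6dL²Mα₀, α₂)`, standing hypotheses from `B8Prop6CubeMember.thm4_hypotheses_one_cutFixed` and `B8LeafModelZd3.mlogCfg_spec`.
§2 `ineq161_of_small` ((1.61) for `α₂ = B·s`); **`norms136_cubeMember`** — PROPOSITION 3 AT THE MEMBER (`prop3Printed_zd3` BY NAME at the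
member built from `B8CubeMemberZd`'s five laws, background `1`, (1.40)₂ by gauge invariance `B8Ineq132.inAk_gaugeAct_iff`, (1.41) = the
(1.62)-shape with `α₂ := 5dLB₀(α₀′ + α₁′)`, (1.42) = (1.38) of record + §1; MODULO `SB9 : ∀ i, SockB9P3 …`, the knit's hypothesis): the
four norm members `≤ 5dLB₀·s`, `5dLB₀β·s`, `s = α₀′ + α₁′`.  The sequel `B8Prop6CubeMemberPrinted` derives every window from print's
«`7dL²Mα₀ ≤ c₁`», «`L ≤ dM`» and packages Proposition 6 at the member with print's constant `7dL²B₁Mα₀` (`B8Prop6OfThm4.const_136`).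

HONEST SCOPE.  (i) `ℤᵈ` carriers, `𝔸` a C⋆-algebra.  (ii) The gauge transformation `u` is DISPLAYED with its properties (n05-c's
conclusion clauses); its existence is not re-derived here.  (iii) Proposition 3 enters through `prop3Printed_zd3`, i.e. MODULO the
Prop.-3-frame b9 socket `SockB9P3` ([4] Thm 3.3 for `G(1)`, `H(1)`) at every member of `ZdIdx d L`, one threshold `cB9` — displayed, not
discharged; the (1.61)-constant `C₂ ≥ 2097152(d+1)²` is a parameter.  (iv) Norm form `≤` of the k-level weighted suprema for print's
pointwise `<` «on □_j».  Count-neutral; N05 NOT discharged; nothing continuum ∕ ℝ⁴ ∕ OS ∕ mass-gap ∕ Clay.  Unit `pub-ymgap-dag-n05-e` (g0),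
2026-08-26.
-/

noncomputable section

open NormedSpace

namespace Literature.MathematicalPhysics.QuantumFieldTheory.Balaban1983to89.B8Prop6CubeMemberNorms

open MatrixLog B7Prop1Explicit B7Prop2Explicit B7Prop1Local B7Eq92Concrete
open B7Prop3Flat (c3 c3_pos)
open B7Prop4GeneralLevels (logCovIter)
open B8Ineq130 (gaugeAct_one)
open B8Ineq132 (covDerivFwd InAk inAk_gaugeAct_iff)
open B8Ineq133 (cutFixed)
open B8Lemma1NonAbelian (mulCfg)
open B8Eq115GaugeFixing (gaugeAct_mul gaugeAct_mem_of)
open B8Eq146AExpansion (iEta plaqCovDeriv)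
open B8Eq143PlaqExpansion (pdiv)
open B8Eq184Proof (cfgExp)
open B8Eq140Level (SideTouches)
open B8Eq119TwistedAxial (InAx Restr129)
open B8ScaledSupNorm (bondNorm msup)
open B8Eq138LandauZd (IsLandau138W logCfg covLap)
open B8Eq131Cubes (tcube tLo tHi ctr)
open B8Eq131CubesAdmissible (cubeFam)
open B8CubeMemberZd (cubeLamS cubeLamB hΩ_cubeFam hbox_cubeLamB hclass_cubeLamB htower_cubeLam hpart_cubeLam)
open B8Prop6CubeMember (thm4_hypotheses_one_cutFixed)
open B8LeafModelZd (ZdIdx)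
open B8LeafModelZd3 (mlogCfg mlogCfg_spec SockB9P3 zdGF3 prop3Printed_zd3)
open B9Eq340HolderZd (hquot AdmPair)
open B8Eq142KLevelLocal (H42_of_inAx)

-- `Site` alone could resolve to the torus sites of `Setup.lean`; re-export the `ℤ^d` sites of `B7Prop1Explicit`.
export B7Prop1Explicit (Site)

variable {d : ℕ}

variable {𝔸 : Type} [CStarAlgebra 𝔸] [Nontrivial 𝔸]

/-! ## §1 (1.42)₂ ∕ (1.37) at all levels for the gauge-fixed field at the member -/

/-- **(1.37) «|Q_j(U₀, ηA)| < 2dLα₁ on Λ_j» AT ALL LEVELS FOR THE GAUGE-FIXED FIELD AT THE CUBE MEMBER** (= Proposition 3's hypothesis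
(1.42)₂), `U₀ = 1`, `α₁ = 6dL²Mα₀` ((1.133)), for the canonical exponent `A := mlogCfg k η {□_j} U₁`, `U₁ = U₀″^{u⁻¹}`.  DATUM: Sect. F's
(as in `B8Prop6CubeMember.thm4_hypotheses_one_cutFixed`, `L ≤ ρ`, `k ≥ 1`); windows at `(α₀′, α₁′, α₂) = (L³α₀, 6dL²Mα₀, α₂)` ([3] Prop. 4's
regime, `16α₂ ≤ 1`, `dLα₁′ ≤ 1∕8`).  ON `u` (any such): unitary, (1.29) `Restr129 L k (cubeLamS … k) 1 u`, and the (1.62)-shape at every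
level `j ≤ k`: `U₁ = e^{iη·(1∕iη) log U₁}`, `(1∕iη) log U₁` Hermitian, `≤ α₂(Lʲη)⁻¹` on the sides of the plaquettes touching `□_j`.
CONCLUSION: `‖Q_j(1, iηA)(c)‖ < 2dL·6dL²Mα₀` for every `j ≤ k`, `c ∈ cubeLamB … k j`.  PROOF: `B8Eq142KLevelLocal.H42_of_inAx` at
`(U₀, U′) := (1, U₀″)` — (1.33) for `1`, (1.34) = (1.132) and (1.35)-box-form = (1.133) from `thm4_hypotheses_one_cutFixed`, the cube laws of
`B8CubeMemberZd`, the exponent clauses from `mlogCfg_spec`. [cite: Balaban1985RegularSpaces, (1.37) p.82, (1.42) p.83, (1.132)–(1.133) p.99, Prop. 6 p.99] -/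
theorem c137_cubeMember (hd2 : 2 ≤ d) {L : ℕ} (hL : 2 ≤ L) {k : ℕ} (hk : 1 ≤ k)
    (U₀ : Site d → Fin d → 𝔸ˣ) (hU₀ : ∀ x κ, U₀ x κ ∈ unitaryUnits 𝔸) {α₀ : ℝ} (hα : 0 < α₀)
    (hα3 : C0 d * (α₀ * (L : ℝ) ^ 2) ≤ 1 / 3) (hα2 : 2 * (α₀ * (L : ℝ) ^ 2) ≤ c2' d L)
    (a : Site d) {M ρ : ℕ} (hρL : L ≤ ρ) (hρM : ρ ≤ M) (hM : 11 * (d : ℝ) < M)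
    {η : ℝ} (hη : 0 < η) {Ω : ℕ → Set (Site d)} (hA : InAk L k η α₀ Ω U₀) (hT : tcube L a M ρ k ⊆ Ω (k - 1))
    (hsmall : 11 * (d : ℝ) ^ 2 * (L : ℝ) ^ 2 * α₀ + ((M : ℝ) + 4 * ρ) * d * (L : ℝ) ^ 2 * α₀ ≤ 1 / 6)
    {α₂ : ℝ} (hα₂ : 0 ≤ α₂) (hα3' : C0 d * ((L : ℝ) ^ 3 * α₀) ≤ 1 / 3) (hα4' : 4 * ((L : ℝ) ^ 3 * α₀) ≤ c2' d L)
    (h16 : 16 * α₂ ≤ 1)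
    (hsm : Real.exp (4 * (800 * ((d : ℝ) + 1) ^ 2 * ((d : ℝ) + 4)) * ((L : ℝ) ^ 3 * α₀))
      * (1 + 8 * (131072 * ((d : ℝ) + 1) ^ 2) * α₂) ≤ 2)
    (hc₃ : 2 * α₂ ≤ c3 d L) (hsmall₁ : (d : ℝ) * L * (6 * d * (L : ℝ) ^ 2 * M * α₀) ≤ 1 / 8)
    (u : Site d → 𝔸ˣ) (hu : ∀ x, u x ∈ unitaryUnits 𝔸)
    (h129 : Restr129 L k (cubeLamS L a M ρ k k) (1 : Site d → Fin d → 𝔸ˣ) u)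
    (h162 : ∀ j, j ≤ k → ∀ b ∈ {b : Site d × Fin d | SideTouches (cubeFam false L a M ρ k j) b.1 b.2},
      gaugeAct u⁻¹ (cutFixed L (tLo a ρ) (tHi a M ρ) U₀ k (ctr a M)) b.1 b.2 =
          cfgExp η (logCfg η (gaugeAct u⁻¹ (cutFixed L (tLo a ρ) (tHi a M ρ) U₀ k (ctr a M)))) b.1 b.2 ∧
        IsSelfAdjoint (logCfg η (gaugeAct u⁻¹ (cutFixed L (tLo a ρ) (tHi a M ρ) U₀ k (ctr a M))) b.1 b.2) ∧
        ‖logCfg η (gaugeAct u⁻¹ (cutFixed L (tLo a ρ) (tHi a M ρ) U₀ k (ctr a M))) b.1 b.2‖ ≤ α₂ * ((L : ℝ) ^ j * η)⁻¹) :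
    ∀ j, j ≤ k → ∀ c ∈ cubeLamB L a M ρ k k j,
      ‖logCovIter L (1 : Site d → Fin d → 𝔸ˣ)
          (iEta η (mlogCfg k η (cubeFam false L a M ρ k) (gaugeAct u⁻¹ (cutFixed L (tLo a ρ) (tHi a M ρ) U₀ k (ctr a M)))))
          j c.1 c.2‖ < 2 * d * L * (6 * d * (L : ℝ) ^ 2 * M * α₀) := by
  have hL1 : 1 ≤ L := le_trans (by norm_num) hL
  have hd1 : 1 ≤ d := le_trans (by norm_num) hd2
  have hρ : 1 ≤ ρ := hL1.trans hρL
  have hM1 : 1 ≤ M := hρ.trans hρM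
  have hLpos : (0 : ℝ) < L := by exact_mod_cast hL1
  have hdpos : (0 : ℝ) < d := by exact_mod_cast hd1
  have hMpos : (0 : ℝ) < M := by exact_mod_cast hM1
  have hα₀' : 0 < (L : ℝ) ^ 3 * α₀ := by positivity
  have hα₁' : 0 < 6 * d * (L : ℝ) ^ 2 * M * α₀ := by positivity
  set U'' := cutFixed L (tLo a ρ) (tHi a M ρ) U₀ k (ctr a M) with hU''
  obtain ⟨hmem, h33, h34, hAx, h135, -⟩ :=
    thm4_hypotheses_one_cutFixed L hL hd1 k U₀ hU₀ hα hα3 hα2 a hρ hρM hM hη hA hT hsmall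
  have hone : ∀ x κ, (1 : Site d → Fin d → 𝔸ˣ) x κ ∈ unitaryUnits 𝔸 := fun _ _ => (unitaryUnits 𝔸).one_mem
  have hU₁u : ∀ x κ, gaugeAct u⁻¹ U'' x κ ∈ unitaryUnits 𝔸 :=
    gaugeAct_mem_of hmem fun x => (unitaryUnits 𝔸).inv_mem (hu x)
  -- the canonical exponent: Hermitian, `= (1/iη) log U₁` on the `E j`, `U₁ = e^{iηA}` there, `0` off them
  obtain ⟨hsa, hrep, hzero⟩ := mlogCfg_spec hη hL1 k (1 : Site d → Fin d → 𝔸ˣ) hU₁u hα₂ h16 (cubeFam false L a M ρ k)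
    (fun j hj y τ hs => ⟨(h162 j hj (y, τ) hs).1, (h162 j hj (y, τ) hs).2.2⟩)
  have hWA : ∀ j, j ≤ k → ∀ y τ, SideTouches (cubeFam false L a M ρ k j) y τ →
      gaugeAct u⁻¹ U'' y τ = cfgExp η (mlogCfg k η (cubeFam false L a M ρ k) (gaugeAct u⁻¹ U'')) y τ ∧
        ‖mlogCfg k η (cubeFam false L a M ρ k) (gaugeAct u⁻¹ U'') y τ‖ ≤ α₂ * ((L : ℝ) ^ j * η)⁻¹ := fun j hj y τ hs =>
    ⟨(hrep j hj y τ hs).2, by rw [(hrep j hj y τ hs).1]; exact (h162 j hj (y, τ) hs).2.2⟩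
  -- `U₁^{u} = U₀″`
  have hgU : mgauge (1 : Site d → Fin d → 𝔸ˣ) u (gaugeAct u⁻¹ U'') = U'' := by
    rw [mgauge_one_left, ← gaugeAct_mul, mul_inv_cancel, gaugeAct_one]
  exact H42_of_inAx hd2 hη hL k hone hα₀' hα₁' hα₂ hα3' hα4' h16 hsm hc₃ hsmall₁ (cubeFam false L a M ρ k)
    (hΩ_cubeFam hL1 a M hρL k) (cubeLamS L a M ρ k) (cubeLamB L a M ρ k) (hbox_cubeLamB L a M ρ k) (hclass_cubeLamB L a M ρ k)
    h33 h34 hAx h135 (fun _ _ => True) k hk le_rfl u (gaugeAct u⁻¹ U'') _ hu hgU h129 trivial hsa hWA hzero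

/-! ## §2 Proposition 3 at the member: the norm members (1.136)₂–₄ and the Hölder member -/

/-- **(1.61) for `α₂ = B·s`** («Proposition 3 implies that it is enough to prove (1.37), (1.38) and |A| < B′₁(α₀ + α₁)(Lʲη)⁻¹», p. 88):
if `α₀ ≤ s`, `0 ≤ s`, `0 ≤ B` and `((2 + 2C₂)B² + 20dB)·s ≤ 1` then `2α₂² + 20dα₀α₂ + 2C₂α₂² ≤ s` for `α₂ = Bs`.
[cite: Balaban1985RegularSpaces, (1.61) p.86, p.88 (sentence after Theorem 4)] -/
theorem ineq161_of_small {d α₀ s B C₂ : ℝ} (hd : 0 ≤ d) (hα₀s : α₀ ≤ s) (hs : 0 ≤ s) (hB : 0 ≤ B)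
    (hsmall : ((2 + 2 * C₂) * B ^ 2 + 20 * d * B) * s ≤ 1) :
    2 * (B * s) ^ 2 + 20 * d * α₀ * (B * s) + 2 * C₂ * (B * s) ^ 2 ≤ s := by
  have h1 : 2 * (B * s) ^ 2 + 20 * d * α₀ * (B * s) + 2 * C₂ * (B * s) ^ 2
      ≤ (((2 + 2 * C₂) * B ^ 2 + 20 * d * B) * s) * s := by
    have : 20 * d * α₀ * (B * s) ≤ 20 * d * s * (B * s) :=
      mul_le_mul_of_nonneg_right (mul_le_mul_of_nonneg_left hα₀s (by positivity)) (by positivity)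
    nlinarith
  calc _ ≤ (((2 + 2 * C₂) * B ^ 2 + 20 * d * B) * s) * s := h1
    _ ≤ 1 * s := mul_le_mul_of_nonneg_right hsmall hs
    _ = s := one_mul s

/-- **PROPOSITION 3 (p. 87) AT THE CONCRETE CUBE MEMBER, BACKGROUND `1`: THE NORM MEMBERS OF (1.136)** — «thus there exists a gauge
transformation u such that U₁ = U₀″^{u⁻¹} satisfies the conditions (1.36)–(1.39)» (p. 99), the (1.36)₂ ∕ Hölder ∕ (1.39) part.  For `d, L ≥ 2`,
`B₀, B₀′ > 0` with `5dLB₀ ≥ 2`, `B₀β ≥ 0`, `C₂ ≥ 2097152(d+1)²`, `cB9 > 0`, Hölder data `β, len`, and the Prop.-3-frame b9 socket for every member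
(`SB9`, as in the N05 knit): ONE threshold `c > 0` (Proposition 3's, `prop3Printed_zd3`) such that for every datum of Sect. F (`k ≥ 1`,
`L ≤ ρ ≤ M`, `11d < M`, unitary `U₀ ∈ 𝔄_k({Ω_j}, α₀)`, `□̃ ⊂ Ω_{k−1}`, the (1.130)-regime) whose parameters `(α₀′, α₁′, α₂) := (L³α₀,
6dL²Mα₀, 5dLB₀(α₀′ + α₁′))` are `≤ c` and satisfy (1.61) and the windows of `c137_cubeMember`, and for every unitary `u` with (1.29) at level
`k`, (1.38) of record `IsLandau138W … 1 U₁` and the (1.62)-shape with constant `α₂` (Theorem 4's output at the member,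
`B8Prop6CubeMemberFlat.prop6_exists_cubeMember_at`), with `A := mlogCfg k η {□_j} U₁`, `s := α₀′ + α₁′`:
`|∇^η A|₍₋₂₎ ≤ 5dLB₀·s`, the Hölder member `≤ 5dLB₀β·s`, `|∂^{η*}∂^η A|₍₋₃₎ ≤ 5dLB₀·s`, `|Δ^η A|₍₋₃₎ ≤ 5dLB₀·s`.  PROOF: `prop3Printed_zd3` at the
member `⟨η, k, {□_j}, cubeLamS, cubeLamB, laws⟩` (`B8CubeMemberZd`), (1.40)₁ for `1`, (1.40)₂ for `U₁·1` by gauge invariance from (1.132),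
(1.41) = the (1.62)-shape, (1.42) = (1.38) + `c137_cubeMember`. [cite: Balaban1985RegularSpaces, Prop. 3 p.87, Prop. 6 (1.136) p.99, (1.40)–(1.42) p.83, (1.61) p.86, p.88] -/
theorem norms136_cubeMember (hd2 : 2 ≤ d) {L : ℕ} (hL : 2 ≤ L) {B₀ B₀' B₀β C₂ cB9 : ℝ} (hB₀ : 0 < B₀) (hB₀' : 0 < B₀')
    (hB₀β : 0 ≤ B₀β) (hC₂ : 2097152 * ((d : ℝ) + 1) ^ 2 ≤ C₂) (hcB9 : 0 < cB9) (β : ℝ) (len : Site d → ℝ)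
    (SB9 : ∀ i : ZdIdx d L, SockB9P3 (𝔸 := 𝔸) L B₀ B₀β cB9 β len i.η i.k i.Ω i.Λs i.Λb) :
    ∃ c : ℝ, 0 < c ∧ ∀ (η : ℝ) (hη : 0 < η) (k : ℕ), 1 ≤ k → ∀ (a : Site d) (M ρ : ℕ), L ≤ ρ → ρ ≤ M → 11 * (d : ℝ) < M →
      ∀ (U₀ : Site d → Fin d → 𝔸ˣ), (∀ x κ, U₀ x κ ∈ unitaryUnits 𝔸) → ∀ (α₀ : ℝ), 0 < α₀ →
      C0 d * (α₀ * (L : ℝ) ^ 2) ≤ 1 / 3 → 2 * (α₀ * (L : ℝ) ^ 2) ≤ c2' d L →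
      ∀ (Ω : ℕ → Set (Site d)), InAk L k η α₀ Ω U₀ → tcube L a M ρ k ⊆ Ω (k - 1) →
      11 * (d : ℝ) ^ 2 * (L : ℝ) ^ 2 * α₀ + ((M : ℝ) + 4 * ρ) * d * (L : ℝ) ^ 2 * α₀ ≤ 1 / 6 →
      -- Proposition 3's windows at `(α₀′, α₁′, α₂)` and (1.61)
      (L : ℝ) ^ 3 * α₀ ≤ c → 6 * d * (L : ℝ) ^ 2 * M * α₀ ≤ c →
      5 * (d : ℝ) * L * B₀ * ((L : ℝ) ^ 3 * α₀ + 6 * d * (L : ℝ) ^ 2 * M * α₀) ≤ c →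
      2 * (5 * (d : ℝ) * L * B₀ * ((L : ℝ) ^ 3 * α₀ + 6 * d * (L : ℝ) ^ 2 * M * α₀)) ^ 2
        + 20 * d * ((L : ℝ) ^ 3 * α₀) * (5 * (d : ℝ) * L * B₀ * ((L : ℝ) ^ 3 * α₀ + 6 * d * (L : ℝ) ^ 2 * M * α₀))
        + 2 * C₂ * (5 * (d : ℝ) * L * B₀ * ((L : ℝ) ^ 3 * α₀ + 6 * d * (L : ℝ) ^ 2 * M * α₀)) ^ 2
        ≤ (L : ℝ) ^ 3 * α₀ + 6 * d * (L : ℝ) ^ 2 * M * α₀ →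
      -- the windows of `c137_cubeMember`
      C0 d * ((L : ℝ) ^ 3 * α₀) ≤ 1 / 3 → 4 * ((L : ℝ) ^ 3 * α₀) ≤ c2' d L →
      16 * (5 * (d : ℝ) * L * B₀ * ((L : ℝ) ^ 3 * α₀ + 6 * d * (L : ℝ) ^ 2 * M * α₀)) ≤ 1 →
      Real.exp (4 * (800 * ((d : ℝ) + 1) ^ 2 * ((d : ℝ) + 4)) * ((L : ℝ) ^ 3 * α₀))
        * (1 + 8 * (131072 * ((d : ℝ) + 1) ^ 2) * (5 * (d : ℝ) * L * B₀ * ((L : ℝ) ^ 3 * α₀ + 6 * d * (L : ℝ) ^ 2 * M * α₀))) ≤ 2 →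
      2 * (5 * (d : ℝ) * L * B₀ * ((L : ℝ) ^ 3 * α₀ + 6 * d * (L : ℝ) ^ 2 * M * α₀)) ≤ c3 d L →
      (d : ℝ) * L * (6 * d * (L : ℝ) ^ 2 * M * α₀) ≤ 1 / 8 →
      ∀ (u : Site d → 𝔸ˣ), (∀ x, u x ∈ unitaryUnits 𝔸) →
      Restr129 L k (cubeLamS L a M ρ k k) (1 : Site d → Fin d → 𝔸ˣ) u →
      IsLandau138W L k η (cubeFam false L a M ρ k 0) (cubeLamS L a M ρ k k) (1 : Site d → Fin d → 𝔸ˣ)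
        (gaugeAct u⁻¹ (cutFixed L (tLo a ρ) (tHi a M ρ) U₀ k (ctr a M))) →
      (∀ j, j ≤ k → ∀ b ∈ {b : Site d × Fin d | SideTouches (cubeFam false L a M ρ k j) b.1 b.2},
        gaugeAct u⁻¹ (cutFixed L (tLo a ρ) (tHi a M ρ) U₀ k (ctr a M)) b.1 b.2 =
            cfgExp η (logCfg η (gaugeAct u⁻¹ (cutFixed L (tLo a ρ) (tHi a M ρ) U₀ k (ctr a M)))) b.1 b.2 ∧
          IsSelfAdjoint (logCfg η (gaugeAct u⁻¹ (cutFixed L (tLo a ρ) (tHi a M ρ) U₀ k (ctr a M))) b.1 b.2) ∧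
          ‖logCfg η (gaugeAct u⁻¹ (cutFixed L (tLo a ρ) (tHi a M ρ) U₀ k (ctr a M))) b.1 b.2‖ ≤
            (5 * (d : ℝ) * L * B₀ * ((L : ℝ) ^ 3 * α₀ + 6 * d * (L : ℝ) ^ 2 * M * α₀)) * ((L : ℝ) ^ j * η)⁻¹) →
      msup L k η (-(2 : ℝ)) (fun j (t : Fin d × Fin d × Site d) => SideTouches (cubeFam false L a M ρ k j) t.2.2 t.2.1)
          (fun t => covDerivFwd η (1 : Site d → Fin d → 𝔸ˣ) t.1 (fun z => mlogCfg k η (cubeFam false L a M ρ k)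
            (gaugeAct u⁻¹ (cutFixed L (tLo a ρ) (tHi a M ρ) U₀ k (ctr a M))) z t.2.1) t.2.2)
        ≤ 5 * (d : ℝ) * L * B₀ * ((L : ℝ) ^ 3 * α₀ + 6 * d * (L : ℝ) ^ 2 * M * α₀) ∧
      msup L k η (-(2 + β)) (fun j (q : Fin d × Fin d × (Site d × Site d)) => q.2.2 ∈ AdmPair η len ∧ q.2.2.1 ∈ cubeFam false L a M ρ k j)
          (fun q => hquot η β len (1 : Site d → Fin d → 𝔸ˣ) (covDerivFwd η (1 : Site d → Fin d → 𝔸ˣ) q.1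
            (fun z => mlogCfg k η (cubeFam false L a M ρ k) (gaugeAct u⁻¹ (cutFixed L (tLo a ρ) (tHi a M ρ) U₀ k (ctr a M))) z q.2.1))
            q.2.2)
        ≤ 5 * (d : ℝ) * L * B₀β * ((L : ℝ) ^ 3 * α₀ + 6 * d * (L : ℝ) ^ 2 * M * α₀) ∧
      bondNorm L k η (-(3 : ℝ)) (cubeFam false L a M ρ k) (fun x μ => pdiv η (1 : Site d → Fin d → 𝔸ˣ)
          (plaqCovDeriv η (1 : Site d → Fin d → 𝔸ˣ) (mlogCfg k η (cubeFam false L a M ρ k)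
            (gaugeAct u⁻¹ (cutFixed L (tLo a ρ) (tHi a M ρ) U₀ k (ctr a M))))) μ x)
        ≤ 5 * (d : ℝ) * L * B₀ * ((L : ℝ) ^ 3 * α₀ + 6 * d * (L : ℝ) ^ 2 * M * α₀) ∧
      bondNorm L k η (-(3 : ℝ)) (cubeFam false L a M ρ k) (fun x μ => covLap η (1 : Site d → Fin d → 𝔸ˣ)
          (fun z => mlogCfg k η (cubeFam false L a M ρ k) (gaugeAct u⁻¹ (cutFixed L (tLo a ρ) (tHi a M ρ) U₀ k (ctr a M))) z μ) x)
        ≤ 5 * (d : ℝ) * L * B₀ * ((L : ℝ) ^ 3 * α₀ + 6 * d * (L : ℝ) ^ 2 * M * α₀) := by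
  have hL1 : 1 ≤ L := le_trans (by norm_num) hL
  have hd1 : 1 ≤ d := le_trans (by norm_num) hd2
  -- Proposition 3 on the `ℤᵈ` family (n05-a's instance, modulo `SB9`), with the leaf's B9 inputs `(B₀, B₀′)`
  obtain ⟨c, hc, H3⟩ := prop3Printed_zd3 (𝔸 := 𝔸) hd2 hL ⟨B₀, B₀', hB₀, hB₀'⟩ hB₀β hC₂ hcB9 β len SB9
  refine ⟨c, hc, ?_⟩
  intro η hη k hk a M ρ hρL hρM hM U₀ hU₀ α₀ hα hα3 hα2 Ω hA hT hsmall hc₀ hc₁ hc₂ h61 hα3' hα4' h16 hsm hc₃ hsmall₁ u hu h129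
    hLan h162
  have hρ : 1 ≤ ρ := hL1.trans hρL
  have hM1 : 1 ≤ M := hρ.trans hρM
  have hLpos : (0 : ℝ) < L := by exact_mod_cast hL1
  have hdpos : (0 : ℝ) < d := by exact_mod_cast hd1
  have hMpos : (0 : ℝ) < M := by exact_mod_cast hM1
  have hα₀' : 0 < (L : ℝ) ^ 3 * α₀ := by positivity
  have hα₁' : 0 < 6 * d * (L : ℝ) ^ 2 * M * α₀ := by positivity
  have hα₂ : 0 < 5 * (d : ℝ) * L * B₀ * ((L : ℝ) ^ 3 * α₀ + 6 * d * (L : ℝ) ^ 2 * M * α₀) := by positivity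
  set U'' := cutFixed L (tLo a ρ) (tHi a M ρ) U₀ k (ctr a M) with hU''
  obtain ⟨hmem, h33, h34, -, -, -⟩ := thm4_hypotheses_one_cutFixed L hL hd1 k U₀ hU₀ hα hα3 hα2 a hρ hρM hM hη hA hT hsmall
  have hone : ∀ x κ, (1 : Site d → Fin d → 𝔸ˣ) x κ ∈ unitaryUnits 𝔸 := fun _ _ => (unitaryUnits 𝔸).one_mem
  have hui : ∀ x, u⁻¹ x ∈ U1 𝔸 := fun x => unitaryUnits_le_U1 ((unitaryUnits 𝔸).inv_mem (hu x))
  have hU₁u : ∀ x κ, gaugeAct u⁻¹ U'' x κ ∈ unitaryUnits 𝔸 :=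
    gaugeAct_mem_of hmem fun x => (unitaryUnits 𝔸).inv_mem (hu x)
  -- (1.40)₂ for `U₁·1 = (U₀″)^{u⁻¹}` by gauge invariance from (1.132)
  have hW : mulCfg U'' (1 : Site d → Fin d → 𝔸ˣ) = U'' := mul_one _
  have hW₁ : mulCfg (gaugeAct u⁻¹ U'') (1 : Site d → Fin d → 𝔸ˣ) = gaugeAct u⁻¹ U'' := mul_one _
  have hPair : InAk L k η ((L : ℝ) ^ 3 * α₀) (cubeFam false L a M ρ k) (mulCfg (gaugeAct u⁻¹ U'') (1 : Site d → Fin d → 𝔸ˣ)) := by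
    rw [hW₁, inAk_gaugeAct_iff L k η _ _ hui]
    rw [hW] at h34
    exact h34
  -- (1.42)₂ at all levels (§1)
  have h137 := c137_cubeMember hd2 hL hk U₀ hU₀ hα hα3 hα2 a hρL hρM hM hη hA hT hsmall hα₂.le hα3' hα4' h16 hsm hc₃ hsmall₁ u hu
    h129 h162
  -- (1.41) in Proposition 3's shape `C162 1 α₂`
  have h41 : ∀ j, j ≤ k → ∀ b ∈ {b : Site d × Fin d | SideTouches (cubeFam false L a M ρ k j) b.1 b.2},
      gaugeAct u⁻¹ U'' b.1 b.2 = cfgExp η (logCfg η (gaugeAct u⁻¹ U'')) b.1 b.2 ∧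
        IsSelfAdjoint (logCfg η (gaugeAct u⁻¹ U'') b.1 b.2) ∧
        ‖logCfg η (gaugeAct u⁻¹ U'') b.1 b.2‖ ≤
          1 * (5 * (d : ℝ) * L * B₀ * ((L : ℝ) ^ 3 * α₀ + 6 * d * (L : ℝ) ^ 2 * M * α₀)) * ((L : ℝ) ^ j * η)⁻¹ := by
    intro j hj b hb
    rw [one_mul]
    exact h162 j hj b hb
  -- the cube member of the index and Proposition 3 at it
  let i : ZdIdx d L := ⟨η, hη, k, hk, cubeFam false L a M ρ k, hΩ_cubeFam hL1 a M hρL k, cubeLamS L a M ρ k, cubeLamB L a M ρ k,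
    hbox_cubeLamB L a M ρ k, hclass_cubeLamB L a M ρ k, htower_cubeLam hL1 a M ρ k, hpart_cubeLam hL1 a M ρ k⟩
  have key := H3 i ((L : ℝ) ^ 3 * α₀) (6 * d * (L : ℝ) ^ 2 * M * α₀)
    (5 * (d : ℝ) * L * B₀ * ((L : ℝ) ^ 3 * α₀ + 6 * d * (L : ℝ) ^ 2 * M * α₀)) hα₀' hc₀ hα₁' hc₁ hα₂ hc₂ h61
    ⟨(1 : Site d → Fin d → 𝔸ˣ), hone⟩ (⟨(1 : Site d → Fin d → 𝔸ˣ), hone⟩, ⟨gaugeAct u⁻¹ U'', hU₁u⟩) h33 trivial hPair h41 hLan h137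
  obtain ⟨⟨-, h36g, h36h⟩, h39j, h39l⟩ := key
  exact ⟨h36g, h36h, h39j, h39l⟩

end Literature.MathematicalPhysics.QuantumFieldTheory.Balaban1983to89.B8Prop6CubeMemberNorms

end
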